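import Literature.IUT.HodgeTheaters.BadLocalFrobenioidDash
import Literature.IUT.HodgeTheaters.BadLocalFrobenioid
import HarnessLib

/-!
# [IUTchI] Example 3.2 assembled: `BadLocalFrobenioid.ofKits` — the interface of Ex. 3.2 with REAL bases
# `D_v ⊇ D⊢_v`, `Ÿ_v`, `D^Θ_v`, REAL `p_v`-adic Frobenioids `C⊢_v ⥲ C^Θ_v`, over a tempered-side INPUT (MERGE L5 × L1)

Mochizuki, *Inter-universal Teichmüller Theory I*, kurims manuscript (May 2020), Example 3.2 (i)–(v) pp. 69–73
[cite: Mochizuki2012, I Ex 3.2 pp.69-73] (D-0012 claim key, status disputed; nothing of the series is asserted — this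
file CONSTRUCTS an inhabitant of abc-iut-L5-t2's frozen interface `BadLocalFrobenioid l K_v` (`BadLocalFrobenioid.lean`)
in which everything the tree can construct IS constructed; L5-lead RULINGS #43 (8) GO «L5-t2 (C) Ex 3.2 REAL bad-place
instance», design `HOME/staging/L5/L5-t2/DESIGN-Ex32-BadLocalFrobenioid-ofKits.md`).

DICTIONARY (interface field ← provider):
* (i) `Dv, Ddash, incl, proj, adj` ← `BadLocalGroupDatum` coset models (`BadLocalFrobenioidBases.lean`): `CosetCat Π_v ⊇
  CosetCat G_v` by pull-back along `aug : Π_v → G_v = Gal(K̄_v/K_v)`, left adjoint `push`; (ii) `Ydd` ← `T.ydd`;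
  (v) `DTheta, DThetaIncl, prodEquiv` ← the essential image of `A ↦ Ÿ_v × A` and "forming the product with `Ÿ_v`".
* (iv) `q, qroot, qroot_pow` ← given elements `q_v`, `q̲_v = q_v^{1/2l}` of `𝒪^▷_{K_v} = intNonzero K_v` (at the genuine
  datum: the Tate parameter of `E_{K_v}`, abc-iut-L5-t12/L5-d209's `exists_pow_two_mul_l_eq_tateParameter`); `Cdash,
  CdashBase, tauDashOf` ← `GaloisValDatum.Cdash/CdashBase/tauDashOf` (`BadLocalFrobenioidDash.lean`): abc-iut-L1-t4's
  monogenic [FrdII] Ex. 1.1 (ii) Frobenioid of `ℕ·log_Φ(q̲_v)` over `𝓑(K_v)⁰` with the splittings of the associates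
  of `q̲_v` [cite: MochizukiFrdII2008, Ex 1.1 (ii) p.8].
* (v) `CTheta, CThetaBase` ← `BadLocalGroupDatum.CTheta/CThetaBase` (the monogenic `p_v`-adic Frobenioid OVER `D^Θ_v`);
  `dashThetaEquiv, dashThetaEquiv_base, dashThetaEquiv_tau` ← `dashThetaEquiv` ([FrdI] Cor. 5.4 transport over
  `prodEquiv`), `dashThetaEquivBaseIso`, `dashThetaEquiv_tau` (PROVED); `OTheta, OThetaUnits` ← `PadicFrd.Datum.effMonoid`
  of the `Θ`-datum: "`𝒪^×(T_{A^Θ})·Θ̲_v^ℕ`" = the EFFECTIVE elements `{b ∈ B(A^Θ) | Div_B(b) ∈ Φ(A^Θ)}` of the [FrdII]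
  rational-function monoid (= `𝒪^×_L · q̲_v^ℕ` read as `𝒪^× · Θ̲_v^ℕ`), units = its invertible elements.
* INPUT `TemperedThetaInput` (the [EtTh] side, NOT in the tree — interface data whose docstrings quote print): (i) the
  tempered Frobenioid `F̲_v → D_v` with its Frobenius-trivial objects `T_(−)`; (ii) `F÷_v = F̲_v^birat`, the units
  `𝒪^×(T^÷_{Ÿ_v}) ∋ Θ̲_v`, the group `l·ℤ ⊆ Aut(T_{Ÿ_v})`, and the constants `𝒪^×_{K_v} → 𝒪^×(T^÷_{Ÿ_v})` (Ex. 3.2 (v):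
  "`𝒪^×(T_A) ⥲ 𝒪^×(T_{A^Θ})` induced by `A^Θ = Ÿ_v × A → A`"); (iii) `C_v ⊆ F̲_v` receiving `C⊢_v` faithfully over
  `D⊢_v ⊆ D_v`; (v) `C^Θ_v ⊆ F÷_v` faithful over `D^Θ_v ⊆ (D_v)_{Ÿ_v} → D_v`.
MODELLING CHOICES (disclosed): (1) as in `BadLocalFrobenioidDash.lean`, the generator of `Φ_{C^Θ_v}` is the class of
`q̲_v` READ AS `log Θ̲_v`; (2) `OThetaOf Θ̲′ := OTheta` for every `Θ̲′` — print applies "`A^Θ ↦ 𝒪^×(T_{A^Θ})·Θ̲′^ℕ`" only to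
the members `Θ̲^α_v` of the indeterminacy orbit, whose monoids are pairwise ISOMORPHIC (Rmk. 3.2.3 (i)) and are modelled
by the one effective monoid; for `Θ̲′` off the orbit print's monoid is not modelled; (3) `tauThetaOf Θ̲′` := the splitting
of `u·q̲_v` for a constant unit `u` with `ι(u)·Θ̲_v = Θ̲′` (`Θ̲_v` itself ↦ `q̲_v`; junk `τ(q̲_v)` when no such `u`), so that
the `μ_{2l}`-orbit `τ^Θ_v` is the family `τ(ζ·q̲_v)`. Universe: the interface's `K_v : Type` forces universe `0`.
-/

noncomputable section

/-! ### `𝒪^▷(T_A) = {b ∈ B(A) | Div_B(b) ≥ 0}` for a [FrdII] Ex. 1.1 (ii) datum -/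

namespace Literature.AlgebraicGeometry.Frobenioids.PadicFrd.Datum

open CategoryTheory Opposite

universe v u

variable {D : Type u} [Category.{v} D] {p : ℕ} [Fact p.Prime] (d : Datum D p)

/-- **`𝒪^▷(T_A)`, the effective part of `B(A)`**: the elements of the rational-function monoid `B(A)` whose divisor
`Div_B(b) ∈ Φ(A)^gp` lies in `Φ(A)` — for a `p`-adic Frobenioid "`𝒪^×_L · (generators of Φ)`" ([FrdI] Prop. 2.2's
monoid `𝒪^▷` of the Frobenius-trivial object over `A`; [IUTchI] Ex. 3.2 (v) "`𝒪^×(T_{A^Θ})·Θ̲^ℕ`").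
[cite: MochizukiFrdII2008, Ex 1.1 (ii) p.8] -/
def effSubmonoid (A : D) : Submonoid (d.B.obj (op A)) where
  carrier := {b | ∃ z : d.Φ.obj (op A), Frobenioids.divB d.Φ d.B d.divB (op A) b = Algebra.GrothendieckGroup.of z}
  one_mem' := ⟨1, by rw [map_one, map_one]⟩
  mul_mem' := by
    rintro a b ⟨z, hz⟩ ⟨w, hw⟩
    exact ⟨z * w, by rw [map_mul, hz, hw, map_mul]⟩

/-- Membership in `𝒪^▷(T_A)`. [cite: MochizukiFrdII2008, Ex 1.1 (ii) p.8] -/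
theorem mem_effSubmonoid_iff {A : D} (b : d.B.obj (op A)) :
    b ∈ d.effSubmonoid A ↔
      ∃ z : d.Φ.obj (op A), Frobenioids.divB d.Φ d.B d.divB (op A) b = Algebra.GrothendieckGroup.of z :=
  Iff.rfl

/-- The pull-back maps of `B` preserve effectivity (naturality of `Div_B`). [cite: MochizukiFrdII2008, Ex 1.1 (ii) p.8] -/
theorem map_mem_effSubmonoid {X Y : D} (f : X ⟶ Y) {b : d.B.obj (op Y)} (hb : b ∈ d.effSubmonoid Y) :
    (d.B.map f.op).hom b ∈ d.effSubmonoid X := by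
  obtain ⟨z, hz⟩ := hb
  exact ⟨(d.Φ.map f.op).hom z, by rw [← pullGp_divB, hz, pullGp_of]⟩

/-- The pull-back map `𝒪^▷(T_Y) → 𝒪^▷(T_X)` along `f : X → Y`. [cite: MochizukiFrdII2008, Ex 1.1 (ii) p.8] -/
def effMap {X Y : D} (f : X ⟶ Y) : d.effSubmonoid Y →* d.effSubmonoid X :=
  ((d.B.map f.op).hom.restrict (d.effSubmonoid Y)).codRestrict _ fun b => d.map_mem_effSubmonoid f b.2

/-- Values of `effMap`. [cite: MochizukiFrdII2008, Ex 1.1 (ii) p.8] -/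
@[simp] theorem coe_effMap {X Y : D} (f : X ⟶ Y) (b : d.effSubmonoid Y) :
    ((d.effMap f b : d.effSubmonoid X) : d.B.obj (op X)) = (d.B.map f.op).hom b := rfl

/-- **The monoid `A ↦ 𝒪^▷(T_A)` on `D`** ([FrdI] Def. 1.1 (ii): a contravariant functor to commutative monoids).
[cite: MochizukiFrdII2008, Ex 1.1 (ii) p.8] -/
def effMonoid : Dᵒᵖ ⥤ CommMonCat.{u} where
  obj A := CommMonCat.of (d.effSubmonoid A.unop)
  map f := CommMonCat.ofHom (d.effMap f.unop)
  map_id A := by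
    apply CommMonCat.hom_ext
    refine MonoidHom.ext fun x => Subtype.ext ?_
    change (d.B.map (𝟙 A)).hom x.1 = x.1
    rw [d.B.map_id]
    rfl
  map_comp f g := by
    apply CommMonCat.hom_ext
    refine MonoidHom.ext fun x => Subtype.ext ?_
    change (d.B.map (f ≫ g)).hom x.1 = (d.B.map g).hom ((d.B.map f).hom x.1)
    rw [d.B.map_comp]
    rfl

/-- `𝒪^×(T_A) ⊆ 𝒪^▷(T_A)`: "the submonoid determined by the invertible elements". [cite: MochizukiFrdII2008, Ex 1.1 (ii) p.8] -/
def effUnits (A : Dᵒᵖ) : Submonoid (d.effMonoid.obj A) := IsUnit.submonoid _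

/-- Membership in `𝒪^×(T_A)` is invertibility. [cite: MochizukiFrdII2008, Ex 1.1 (ii) p.8] -/
theorem mem_effUnits_iff (A : Dᵒᵖ) (x : d.effMonoid.obj A) : x ∈ d.effUnits A ↔ IsUnit x :=
  IsUnit.mem_submonoid_iff x

end Literature.AlgebraicGeometry.Frobenioids.PadicFrd.Datum

namespace Literature.IUT.HodgeTheaters

open CategoryTheory Opposite Literature.AnabelianGeometry.SemiGraphs Literature.AlgebraicGeometry.Frobenioids
open Literature.AlgebraicGeometry.Frobenioids.PadicFrd

/-! ### The tempered-side INPUT -/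

/-- **INPUT of [IUTchI] Ex. 3.2 on the [EtTh] side** (objects the tree does not construct), over the REAL bases of a
`BadLocalGroupDatum` and the REAL `C⊢_v`, `C^Θ_v` of `BadLocalFrobenioidDash.lean`, on carriers `Fv` (`F̲_v`), `Fbirat`
(`F÷_v`), `Cv` (`C_v`): (i) p. 70 "a tempered Frobenioid `F̲_v` … over a base category `D_v`", "`T_(−)` the
Frobenius-trivial object … of `F̲_v` [which is completely determined up to isomorphism] that lies over `(−)`"; (ii)
p. 70 "the birationalization `F÷_v := F̲_v^birat`", "`Θ̲_v ∈ 𝒪^×(T^÷_{Ÿ_v})`", p. 71 "the group of automorphisms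
`l·ℤ ⊆ Aut(T_{Ÿ_v})`"; (v) p. 72 the constants "`𝒪^×(T_A) ⥲ 𝒪^×(T_{A^Θ})` [induced by the natural projection
`A^Θ = Ÿ_v × A → A`]" (here: `𝒪^×_{K_v} → 𝒪^×(T^÷_{Ÿ_v})`); (iii)/(iv) p. 71 "`C_v ⊆ F̲_v`", "`C⊢_v (⊆ C_v ⊆ F̲_v → F÷_v)`
— which may be thought of as a subcategory of `C_v`"; (v) p. 72 "`C^Θ_v (⊆ F÷_v)` — which may be thought of as a
subcategory of `F÷_v`". [cite: Mochizuki2012, I Ex 3.2 pp.69-73] -/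
structure TemperedThetaInput {p : ℕ} [Fact p.Prime] (d : GaloisValDatum.{0} p) {P : Type} [Group P]
    [TopologicalSpace P] (T : BadLocalGroupDatum d.Gal P) {qroot : intNonzero d.k} (hq : ¬ IsUnit qroot)
    (Fv : Type) [Category.{0} Fv] (Fbirat : Type) [Category.{0} Fbirat] (Cv : Type) [Category.{0} Cv] where
  /-- (i) `F̲_v → D_v` -/
  toBase : Fv ⥤ T.Dv
  /-- (i) `(−) ↦ T_(−)`, the Frobenius-trivial object over `(−)` … -/
  Tobj : T.Dv → Fv
  /-- … lying over `(−)` -/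
  Tobj_base : ∀ A : T.Dv, toBase.obj (Tobj A) ≅ A
  /-- (ii) `F̲_v → F÷_v` … -/
  birat : Fv ⥤ Fbirat
  /-- … `F÷_v → D_v` … -/
  biratBase : Fbirat ⥤ T.Dv
  /-- … compatibly -/
  birat_base : Nonempty (birat ⋙ biratBase ≅ toBase)
  /-- (ii) `𝒪^×(T^÷_{Ÿ_v}) ⊆ Aut(T^÷_{Ÿ_v})` … -/
  unitsTY : Subgroup (Aut (birat.obj (Tobj T.ydd)))
  /-- … commutative -/
  unitsTY_comm : ∀ x ∈ unitsTY, ∀ y ∈ unitsTY, x * y = y * x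
  /-- (ii) `Θ̲_v` … -/
  theta : Aut (birat.obj (Tobj T.ydd))
  /-- … `∈ 𝒪^×(T^÷_{Ÿ_v})` -/
  theta_mem : theta ∈ unitsTY
  /-- (ii) `l·ℤ ⊆ Aut(T_{Ÿ_v})` -/
  lZ : Subgroup (Aut (Tobj T.ydd))
  /-- (v) the constants `𝒪^×_{K_v} = (𝒪^▷_{K_v})^× → 𝒪^×(T^÷_{Ÿ_v})` -/
  constUnits : (intNonzero d.k)ˣ →* unitsTY
  /-- (iii) `C_v ⊆ F̲_v` … -/
  hull : Cv ⥤ Fv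
  /-- … faithful -/
  hull_faithful : hull.Faithful
  /-- (iv) `C⊢_v ⊆ C_v` … -/
  CdashToC : d.Cdash hq ⥤ Cv
  /-- … faithful … -/
  CdashToC_faithful : CdashToC.Faithful
  /-- … over `D⊢_v ⊆ D_v` -/
  CdashToC_base : Nonempty (CdashToC ⋙ hull ⋙ toBase ≅ d.CdashBase hq ⋙ T.incl)
  /-- (v) `C^Θ_v ⊆ F÷_v` … -/
  CThetaToBirat : T.CTheta d hq ⥤ Fbirat
  /-- … faithful … -/
  CThetaToBirat_faithful : CThetaToBirat.Faithful
  /-- … over `D^Θ_v ⊆ (D_v)_{Ÿ_v} → D_v` -/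
  CThetaToBirat_base : Nonempty (CThetaToBirat ⋙ biratBase ≅ T.CThetaBase d hq ⋙ T.dThetaIncl ⋙ Over.forget T.ydd)

namespace TemperedThetaInput

variable {p : ℕ} [Fact p.Prime] {d : GaloisValDatum.{0} p} {P : Type} [Group P] [TopologicalSpace P]
  {T : BadLocalGroupDatum d.Gal P} {qroot : intNonzero d.k} {hq : ¬ IsUnit qroot}
  {Fv : Type} [Category.{0} Fv] {Fbirat : Type} [Category.{0} Fbirat] {Cv : Type} [Category.{0} Cv]
  (K : TemperedThetaInput d T hq Fv Fbirat Cv)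

open Classical in
/-- **The `Θ`-side splitting attached to `Θ̲′ ∈ Aut(T^÷_{Ÿ_v})`** (interface field `tauThetaOf`): `Θ̲_v ↦ τ(q̲_v)`;
`Θ̲′ = ι(u)·Θ̲_v` for a constant unit `u ∈ 𝒪^×_{K_v}` `↦ τ(u·q̲_v)` (for `u = ζ ∈ μ_{2l}(K_v)` these are the members of
`τ^Θ_v`); junk `τ(q̲_v)` otherwise (module docstring (3)). [cite: Mochizuki2012, I Ex 3.2 (v) p.72] -/
def tauThetaOf (x : Aut (K.birat.obj (K.Tobj T.ydd))) : S3Local.CharSplitting (T.CTheta d hq) :=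
  if x = K.theta then T.tauThetaOf d hq qroot
  else if h : ∃ u : (intNonzero d.k)ˣ, ((K.constUnits u : K.unitsTY) : Aut (K.birat.obj (K.Tobj T.ydd))) * K.theta = x
    then T.tauThetaOf d hq (((Classical.choose h : (intNonzero d.k)ˣ) : intNonzero d.k) * qroot)
  else T.tauThetaOf d hq qroot

/-- `tauThetaOf Θ̲_v = τ(q̲_v)` on `C^Θ_v` ("`q̲_v ↦ Θ̲_v`"). [cite: Mochizuki2012, I Ex 3.2 (v) p.72] -/
theorem tauThetaOf_theta : K.tauThetaOf K.theta = T.tauThetaOf d hq qroot := by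
  rw [tauThetaOf, if_pos rfl]

/-- **`C⊢_v ⥲ C^Θ_v` maps `τ⊢_v` to `τ^Θ_v`** (the members for `q̲_v` and `Θ̲_v`; `dashThetaEquiv_tau` of
`BadLocalFrobenioidDash.lean`). [cite: Mochizuki2012, I Ex 3.2 (v) p.73] -/
theorem tauDashOf_isPreservedBy :
    (d.tauDashOf hq qroot).IsPreservedBy (K.tauThetaOf K.theta) (T.dashThetaEquiv d hq).functor := by
  rw [tauThetaOf_theta]
  exact T.dashThetaEquiv_tau d hq qroot (Associated.refl qroot)

end TemperedThetaInput

/-! ### The assembly -/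

namespace BadLocalFrobenioid

variable {p : ℕ} [Fact p.Prime] (l : ℕ) (d : GaloisValDatum.{0} p) {P : Type} [Group P] [TopologicalSpace P]
  (T : BadLocalGroupDatum d.Gal P) (q qroot : intNonzero d.k) (hpow : qroot ^ (2 * l) = q) (hq : ¬ IsUnit qroot)
  {Fv : Type} [Category.{0} Fv] {Fbirat : Type} [Category.{0} Fbirat] {Cv : Type} [Category.{0} Cv]
  (K : TemperedThetaInput d T hq Fv Fbirat Cv)

/-- **[IUTchI] Example 3.2 with REAL bases and REAL `C⊢_v ⥲ C^Θ_v`**: an inhabitant of the interface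
`BadLocalFrobenioid l K_v` for `K_v := k` of a `GaloisValDatum` (`G_v = Gal(Ω/K_v)`), a bad-place group datum
`Π_v → G_v ⊇ Π_Ÿ`, elements `q̲_v^{2l} = q_v` of `𝒪^▷_{K_v}` with `q̲_v` a non-unit, and a tempered-side input
(module docstring: dictionary and the three disclosed modelling choices). [cite: Mochizuki2012, I Ex 3.2 pp.69-73] -/
def ofKits : BadLocalFrobenioid.{0} l d.k where
  Dv := T.Dv
  Ddash := CosetCat d.Gal
  incl := T.incl
  incl_full := T.incl_full
  incl_faithful := T.incl_faithful
  proj := T.proj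
  adj := T.adj
  Fv := Fv
  toBase := K.toBase
  T := K.Tobj
  T_base := K.Tobj_base
  Fbirat := Fbirat
  birat := K.birat
  biratBase := K.biratBase
  birat_base := K.birat_base
  Ydd := T.ydd
  unitsTY := K.unitsTY
  unitsTY_comm := K.unitsTY_comm
  theta := K.theta
  theta_mem := K.theta_mem
  lZ := K.lZ
  Cv := Cv
  hull := K.hull
  hull_faithful := K.hull_faithful
  q := q
  qroot := qroot
  qroot_pow := hpow
  Cdash := d.Cdash hq
  CdashBase := d.CdashBase hq
  CdashToC := K.CdashToC
  CdashToC_faithful := K.CdashToC_faithful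
  CdashToC_base := K.CdashToC_base
  tauDashOf := d.tauDashOf hq
  DTheta := T.DTheta
  DThetaIncl := T.dThetaIncl
  DThetaIncl_full := T.dThetaIncl_full
  DThetaIncl_faithful := T.dThetaIncl_faithful
  prodEquiv := T.prodEquiv
  OTheta := (T.thetaDatum d hq).effMonoid
  OThetaUnits := (T.thetaDatum d hq).effUnits
  OThetaUnits_isUnit := (T.thetaDatum d hq).mem_effUnits_iff
  OThetaOf := fun _ => (T.thetaDatum d hq).effMonoid
  OThetaOf_theta := rfl
  CTheta := T.CTheta d hq
  CThetaBase := T.CThetaBase d hq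
  CThetaToBirat := K.CThetaToBirat
  CThetaToBirat_faithful := K.CThetaToBirat_faithful
  CThetaToBirat_base := K.CThetaToBirat_base
  tauThetaOf := K.tauThetaOf
  dashThetaEquiv := T.dashThetaEquiv d hq
  dashThetaEquiv_tau := K.tauDashOf_isPreservedBy
  dashThetaEquiv_base := ⟨T.dashThetaEquivBaseIso d hq⟩

/-- The bases of `ofKits` ARE the coset models: `D_v = CosetCat Π_v`, `D⊢_v = CosetCat G_v`, `D^Θ_v` the essential image of
`A ↦ Ÿ_v × A`. [cite: Mochizuki2012, I Ex 3.2 (i)(v) pp.70-72] -/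
theorem ofKits_bases :
    (ofKits l d T q qroot hpow hq K).Dv = CosetCat P ∧ (ofKits l d T q qroot hpow hq K).Ddash = CosetCat d.Gal ∧
      (ofKits l d T q qroot hpow hq K).DTheta = T.DTheta :=
  ⟨rfl, rfl, rfl⟩

/-- `D⊢_v ⊆ D_v → D⊢_v` of `ofKits` ARE pull-back / push-forward along `aug`, and `D⊢_v ⥲ D^Θ_v` IS "forming the
product with `Ÿ_v`". [cite: Mochizuki2012, I Ex 3.2 (i)(v) pp.70-72] -/
theorem ofKits_incl_proj_prodEquiv :
    (ofKits l d T q qroot hpow hq K).incl = T.incl ∧ (ofKits l d T q qroot hpow hq K).proj = T.proj ∧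
      (ofKits l d T q qroot hpow hq K).prodEquiv = T.prodEquiv :=
  ⟨rfl, rfl, rfl⟩

/-- `C⊢_v`, `C^Θ_v` of `ofKits` ARE the REAL `p_v`-adic Frobenioids ([FrdII] Ex. 1.1 (ii) monogenic data over
`𝓑(K_v)⁰` and over `D^Θ_v`), and `C⊢_v ⥲ C^Θ_v` IS the [FrdI] Cor. 5.4 transport over `prodEquiv`.
[cite: Mochizuki2012, I Ex 3.2 (iv)(v) pp.71-72] -/
theorem ofKits_C :
    (ofKits l d T q qroot hpow hq K).Cdash = (d.dashDatum hq).frobenioid ∧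
      (ofKits l d T q qroot hpow hq K).CTheta = (T.thetaDatum d hq).frobenioid ∧
      (ofKits l d T q qroot hpow hq K).dashThetaEquiv = T.dashThetaEquiv d hq :=
  ⟨rfl, rfl, rfl⟩

/-- `𝒪^▷_{C^Θ_v}` of `ofKits` IS the effective monoid of the `Θ`-datum (`𝒪^× · generator^ℕ`).
[cite: Mochizuki2012, I Ex 3.2 (v) p.72] -/
theorem ofKits_OTheta : (ofKits l d T q qroot hpow hq K).OTheta = (T.thetaDatum d hq).effMonoid := rfl

/-- `τ⊢_v` of `ofKits` (the recorded member, for `q̲_v`) is abc-iut-L1-t4's splitting `τ(q̲_v)`.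
[cite: Mochizuki2012, I Ex 3.2 (iv) p.71] -/
theorem ofKits_tauDash : (ofKits l d T q qroot hpow hq K).tauDash = d.tauDashOf hq qroot := rfl

/-- `τ^Θ_v` of `ofKits` (the recorded member, for `Θ̲_v`) is the splitting `τ(q̲_v)` on `C^Θ_v`.
[cite: Mochizuki2012, I Ex 3.2 (v) p.72] -/
theorem ofKits_tauTheta : (ofKits l d T q qroot hpow hq K).tauTheta = T.tauThetaOf d hq qroot :=
  K.tauThetaOf_theta

end BadLocalFrobenioid

end Literature.IUT.HodgeTheaters

end
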